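import Summits.Ventures.PercRepro.ProfilePointedPaving
import Summits.Ventures.PercRepro.ProfilePointedUnifOddRow

/-!
# PercRepro — (Ĉ) HOLDS AT EVERY LEVEL `k` AT WHICH ALL `(k+1)`-SUBSETS ARE INDEPENDENT: THE GIRTH REGIME OF THE
POINTED CONJECTURE, UNCONDITIONAL (p10, gen 25)

For a finite matroid `M` on `N = #E` elements, a point `p` and a level `k` with `2k + 2 ≤ N`, the pointed conjecture (Ĉ)
reads `(N − k − 1)·P_k ≤ k·P_{k+1} + (N − 2k − 1)·c^p_k` (`PointedRow`, gen 13).  ProfilePointedPaving proved it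
unconditionally when every `(k+1)`-subset of `E` is BI-independent.  THIS FILE drops the condition on the complements:

* `pointedRow_level_of_indep_succ` — **if every `(k+1)`-subset of `E` is independent (`k + 2 ≤ girth(M)`) and
  `2k + 2 ≤ N`, then (Ĉ) holds at `(M, p, k)` for every point `p`.**  Proof — a double count on the containments
  `X ⊂ X'` between `BI_k` and `BI_{k+1}`: every `X ∈ BI_k` extends by EVERY outside element
  (`insert_mem_biIndepSets_of_indep_succ`: `X ∪ e` is independent by hypothesis, its complement is a subset of the
  independent `E ∖ X`), so `c^p_k = out_k` (`extCount_eq_outCount_of_indep_succ`) and every `X` has exactly `N − k`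
  up-neighbours; a set `X' ∈ BI_{k+1}` has at most `k` down-neighbours through `p` (`X' ∖ e`, `e ≠ p`), at most `k + 1`
  avoiding `p`, and at most ONE avoiding `p` when `p ∈ X'` (namely `X' ∖ p`).  Hence `(N − k)·in_k ≤ k·in_{k+1}`
  (`inCount_mul_le_of_indep_succ`) and `(N − k)·out_k ≤ in_{k+1} + (k + 1)·out_{k+1}` (`outCount_mul_le_of_indep_succ`),
  and (Ĉ) — in this regime `(N − k − 1)·in_k + k·out_k ≤ k·P_{k+1}` — follows from `k + 1 ≤ N − k`.
* `pointedRowAt_of_indep_half` — **(Ĉ) at every level of every point of every matroid whose girth exceeds `N/2`**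
  (every subset with at most `N/2` elements independent); `pointedRowAt_of_paving'` re-derives the paving theorem.
* `exists_dependent_of_not_pointedRow_level`, `MinimalWitness.exists_failing_level` — a failure of (Ĉ) at level `k` needs
  a DEPENDENT `(k+1)`-set; a minimal witness fails at such a level.  With gen 24's «every 3-subset of a minimal witness
  is independent» (mod Theorem A): `MinimalWitness.three_le_failing_level` (the failing level is `≥ 3`) and
  `MinimalWitness.eight_le_card` (a minimal witness has at least `8` elements).

Nothing here asserts (Ĉ) in general.
-/

open scoped Matroid

namespace PercRepro.Cogirth

open Finset ThmH Skew

variable {α : Type} [DecidableEq α] {M : Matroid α} [M.Finite]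

/-! ### Extension by every outside element -/

/-- If every `(k+1)`-subset of `E` is independent, a bi-independent `k`-set extends to a bi-independent `(k+1)`-set by
EVERY element outside it. -/
theorem insert_mem_biIndepSets_of_indep_succ {k : ℕ} (h1 : ∀ X ⊆ gr M, X.card = k + 1 → rk M X = X.card)
    {X : Finset α} (hX : X ∈ biIndepSets M k) {e : α} (he : e ∈ gr M) (heX : e ∉ X) :
    insert e X ∈ biIndepSets M (k + 1) := by
  rw [mem_biIndepSets] at hX ⊢
  obtain ⟨hXg, hXc, -, hXd⟩ := hX
  have hsub : insert e X ⊆ gr M := insert_subset he hXg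
  have hcard : (insert e X).card = k + 1 := by rw [card_insert_of_notMem heX, hXc]
  refine ⟨hsub, hcard, h1 _ hsub hcard, ?_⟩
  exact rk_eq_card_of_subset_of_rk_eq_card (sdiff_subset_sdiff (subset_refl _) (subset_insert e X)) hXd

/-- In that regime `c^p_k = out_k`: every `p`-avoiding bi-independent `k`-set extends by `p`. -/
theorem extCount_eq_outCount_of_indep_succ {k : ℕ} {p : α} (hp : p ∈ gr M)
    (h1 : ∀ X ⊆ gr M, X.card = k + 1 → rk M X = X.card) :
    extCount M k p = outCount M k p := by
  unfold extCount outCount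
  congr 1
  apply filter_congr
  intro X hX
  exact ⟨fun h => h.1, fun hpX => ⟨hpX, insert_mem_biIndepSets_of_indep_succ h1 hX hp hpX⟩⟩

/-! ### The double count -/

/-- Every `X ∈ BI_k` has at least `N − k` up-neighbours in any family containing all its one-element extensions. -/
theorem le_card_bipartiteAbove_of_indep_succ {k : ℕ}
    {t : Finset (Finset α)} {X : Finset α} (hX : X ∈ biIndepSets M k)
    (ht : ∀ e ∈ gr M, e ∉ X → insert e X ∈ t) :
    (gr M).card - k ≤ (bipartiteAbove (· ⊆ ·) t X).card := by
  have hXg := (mem_biIndepSets.1 hX).1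
  have hXc := (mem_biIndepSets.1 hX).2.1
  have hsub : (gr M \ X).image (fun e => insert e X) ⊆ bipartiteAbove (· ⊆ ·) t X := by
    intro Y hY
    rw [mem_image] at hY
    obtain ⟨e, he, rfl⟩ := hY
    rw [mem_sdiff] at he
    rw [mem_bipartiteAbove]
    exact ⟨ht e he.1 he.2, subset_insert e X⟩
  have hinj : ((gr M \ X).image (fun e => insert e X)).card = (gr M \ X).card := by
    apply card_image_of_injOn
    intro e he e' he' hee'
    simp only [coe_sdiff, Set.mem_sdiff, mem_coe] at he he'
    exact (insert_inj he.2).1 hee'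
  have := card_le_card hsub
  rw [hinj, card_sdiff_of_subset hXg, hXc] at this
  exact this

/-- A `(k+1)`-set `X'` has at most `k` bi-independent `k`-subsets THROUGH `p` (they are `X' ∖ e`, `e ∈ X' ∖ p`). -/
theorem card_bipartiteBelow_in_le {k : ℕ} {p : α} {X' : Finset α} (hX' : X' ∈ biIndepSets M (k + 1)) :
    (bipartiteBelow (· ⊆ ·) ((biIndepSets M k).filter (fun X => p ∈ X)) X').card ≤ k := by
  have hX'c := (mem_biIndepSets.1 hX').2.1
  by_cases hpX' : p ∈ X'
  · have hsub : bipartiteBelow (· ⊆ ·) ((biIndepSets M k).filter (fun X => p ∈ X)) X' ⊆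
        (X'.erase p).image (fun e => X'.erase e) := by
      intro X hX
      rw [mem_bipartiteBelow, mem_filter] at hX
      obtain ⟨⟨hXk, hpX⟩, hXX'⟩ := hX
      have hXc := (mem_biIndepSets.1 hXk).2.1
      have h1 : (X' \ X).card = 1 := by
        rw [card_sdiff_of_subset hXX', hX'c, hXc]
        omega
      obtain ⟨e, he⟩ := card_eq_one.1 h1
      have heX' : e ∈ X' := by
        have : e ∈ X' \ X := by rw [he]; exact mem_singleton_self e
        exact (mem_sdiff.1 this).1
      have heX : e ∉ X := by
        have : e ∈ X' \ X := by rw [he]; exact mem_singleton_self e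
        exact (mem_sdiff.1 this).2
      rw [mem_image]
      refine ⟨e, mem_erase.2 ⟨fun h => heX (h ▸ hpX), heX'⟩, ?_⟩
      symm
      apply eq_of_subset_of_card_le
      · intro x hx
        rw [mem_erase]
        exact ⟨fun h => heX (h ▸ hx), hXX' hx⟩
      · rw [card_erase_of_mem heX', hX'c, hXc]
        omega
    have := card_le_card hsub
    refine this.trans (card_image_le.trans ?_)
    rw [card_erase_of_mem hpX', hX'c]
    exact Nat.le_refl _
  · have : bipartiteBelow (· ⊆ ·) ((biIndepSets M k).filter (fun X => p ∈ X)) X' = ∅ := by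
      rw [eq_empty_iff_forall_notMem]
      intro X hX
      rw [mem_bipartiteBelow, mem_filter] at hX
      exact hpX' (hX.2 hX.1.2)
    rw [this, card_empty]
    exact Nat.zero_le _

/-- A `(k+1)`-set has at most `k + 1` bi-independent `k`-subsets avoiding `p`. -/
theorem card_bipartiteBelow_out_le {k : ℕ} {p : α} {X' : Finset α} (hX' : X' ∈ biIndepSets M (k + 1)) :
    (bipartiteBelow (· ⊆ ·) ((biIndepSets M k).filter (fun X => p ∉ X)) X').card ≤ k + 1 := by
  have hX'c := (mem_biIndepSets.1 hX').2.1
  have hsub : bipartiteBelow (· ⊆ ·) ((biIndepSets M k).filter (fun X => p ∉ X)) X' ⊆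
      X'.powersetCard k := by
    intro X hX
    rw [mem_bipartiteBelow, mem_filter] at hX
    rw [mem_powersetCard]
    exact ⟨hX.2, (mem_biIndepSets.1 hX.1.1).2.1⟩
  have := card_le_card hsub
  rwa [card_powersetCard, hX'c, Nat.choose_succ_self_right] at this

/-- A `(k+1)`-set THROUGH `p` has at most one bi-independent `k`-subset avoiding `p` (namely `X' ∖ p`). -/
theorem card_bipartiteBelow_out_le_one {k : ℕ} {p : α} {X' : Finset α} (hX' : X' ∈ biIndepSets M (k + 1))
    (hpX' : p ∈ X') :
    (bipartiteBelow (· ⊆ ·) ((biIndepSets M k).filter (fun X => p ∉ X)) X').card ≤ 1 := by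
  have hX'c := (mem_biIndepSets.1 hX').2.1
  have hsub : bipartiteBelow (· ⊆ ·) ((biIndepSets M k).filter (fun X => p ∉ X)) X' ⊆ {X'.erase p} := by
    intro X hX
    rw [mem_bipartiteBelow, mem_filter] at hX
    obtain ⟨⟨hXk, hpX⟩, hXX'⟩ := hX
    rw [mem_singleton]
    apply eq_of_subset_of_card_le
    · intro x hx
      rw [mem_erase]
      exact ⟨fun h => hpX (h ▸ hx), hXX' hx⟩
    · rw [card_erase_of_mem hpX', hX'c, (mem_biIndepSets.1 hXk).2.1]
      omega
  have := card_le_card hsub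
  rwa [card_singleton] at this

/-- **`(N − k)·in_k ≤ k·in_{k+1}`** when every `(k+1)`-subset is independent. -/
theorem inCount_mul_le_of_indep_succ {k : ℕ} {p : α}
    (h1 : ∀ X ⊆ gr M, X.card = k + 1 → rk M X = X.card) :
    inCount M k p * ((gr M).card - k) ≤ inCount M (k + 1) p * k := by
  unfold inCount
  apply card_mul_le_card_mul (· ⊆ ·)
  · intro X hX
    rw [mem_filter] at hX
    apply le_card_bipartiteAbove_of_indep_succ hX.1
    intro e he heX
    rw [mem_filter]
    exact ⟨insert_mem_biIndepSets_of_indep_succ h1 hX.1 he heX, mem_insert_of_mem hX.2⟩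
  · intro X' hX'
    rw [mem_filter] at hX'
    exact card_bipartiteBelow_in_le hX'.1

/-- **`(N − k)·out_k ≤ in_{k+1} + (k + 1)·out_{k+1}`** when every `(k+1)`-subset is independent. -/
theorem outCount_mul_le_of_indep_succ {k : ℕ} {p : α}
    (h1 : ∀ X ⊆ gr M, X.card = k + 1 → rk M X = X.card) :
    outCount M k p * ((gr M).card - k) ≤ inCount M (k + 1) p + outCount M (k + 1) p * (k + 1) := by
  have hid := sum_card_bipartiteAbove_eq_sum_card_bipartiteBelow (· ⊆ ·)
    (s := (biIndepSets M k).filter (fun X => p ∉ X)) (t := biIndepSets M (k + 1))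
  have hlow : ((biIndepSets M k).filter (fun X => p ∉ X)).card * ((gr M).card - k) ≤
      ∑ X ∈ (biIndepSets M k).filter (fun X => p ∉ X), (bipartiteAbove (· ⊆ ·) (biIndepSets M (k + 1)) X).card := by
    rw [card_eq_sum_ones, sum_mul, one_mul]
    apply sum_le_sum
    intro X hX
    rw [mem_filter] at hX
    exact le_card_bipartiteAbove_of_indep_succ hX.1 (fun e he heX =>
      insert_mem_biIndepSets_of_indep_succ h1 hX.1 he heX)
  have hup : ∑ X' ∈ biIndepSets M (k + 1),
      (bipartiteBelow (· ⊆ ·) ((biIndepSets M k).filter (fun X => p ∉ X)) X').card ≤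
      inCount M (k + 1) p + outCount M (k + 1) p * (k + 1) := by
    rw [← sum_filter_add_sum_filter_not (biIndepSets M (k + 1)) (fun X' => p ∈ X')]
    unfold inCount outCount
    rw [card_eq_sum_ones, card_eq_sum_ones, sum_mul]
    apply Nat.add_le_add
    · apply sum_le_sum
      intro X' hX'
      rw [mem_filter] at hX'
      exact card_bipartiteBelow_out_le_one hX'.1 hX'.2
    · apply sum_le_sum
      intro X' hX'
      rw [mem_filter] at hX'
      rw [one_mul]
      exact card_bipartiteBelow_out_le hX'.1
  unfold outCount
  calc ((biIndepSets M k).filter (fun X => p ∉ X)).card * ((gr M).card - k)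
      ≤ ∑ X ∈ (biIndepSets M k).filter (fun X => p ∉ X),
          (bipartiteAbove (· ⊆ ·) (biIndepSets M (k + 1)) X).card := hlow
    _ = ∑ X' ∈ biIndepSets M (k + 1),
          (bipartiteBelow (· ⊆ ·) ((biIndepSets M k).filter (fun X => p ∉ X)) X').card := hid
    _ ≤ _ := hup

/-! ### The theorem -/

/-- **(Ĉ) AT EVERY LEVEL `k` AT WHICH ALL `(k+1)`-SUBSETS ARE INDEPENDENT** (UNCONDITIONAL): for `2k + 2 ≤ N` and every
point `p`, `(N − k − 1)·P_k ≤ k·P_{k+1} + (N − 2k − 1)·c^p_k`. -/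
theorem pointedRow_level_of_indep_succ {k : ℕ} (hk : 2 * k + 2 ≤ (gr M).card) {p : α} (hp : p ∈ gr M)
    (h1 : ∀ X ⊆ gr M, X.card = k + 1 → rk M X = X.card) :
    ((gr M).card - k - 1) * (biIndepSets M k).card ≤
      k * (biIndepSets M (k + 1)).card + ((gr M).card - 2 * k - 1) * extCount M k p := by
  rw [extCount_eq_outCount_of_indep_succ hp h1, ← inCount_add_outCount M k p, ← inCount_add_outCount M (k + 1) p]
  have hI := inCount_mul_le_of_indep_succ (M := M) (p := p) h1
  have hO := outCount_mul_le_of_indep_succ (M := M) (p := p) h1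
  obtain ⟨m, hm⟩ := Nat.exists_eq_add_of_le hk
  rw [hm] at hI hO ⊢
  rw [show 2 * k + 2 + m - k = k + 2 + m by omega] at hI hO
  rw [show 2 * k + 2 + m - k - 1 = k + 1 + m by omega, show 2 * k + 2 + m - 2 * k - 1 = m + 1 by omega]
  generalize inCount M k p = a at hI hO ⊢
  generalize outCount M k p = b at hI hO ⊢
  generalize inCount M (k + 1) p = a' at hI hO ⊢
  generalize outCount M (k + 1) p = b' at hI hO ⊢
  -- goal: (k+1+m)(a+b) ≤ k(a'+b') + (m+1)b ; from a(k+2+m) ≤ a'k, b(k+2+m) ≤ a' + b'(k+1)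
  apply Nat.le_of_mul_le_mul_left (c := k + 2 + m) _ (by omega)
  have hI' := Nat.mul_le_mul_left (k + 1 + m) hI
  have hO' := Nat.mul_le_mul_left k hO
  have hb' : k * (k + 1) * b' ≤ k * (k + 2 + m) * b' := Nat.mul_le_mul_right _ (Nat.mul_le_mul_left _ (by omega))
  nlinarith [hI', hO', hb']

/-- **(Ĉ) AT EVERY LEVEL OF EVERY POINT OF EVERY MATROID WHOSE GIRTH EXCEEDS `N / 2`** (every subset with at most `N/2`
elements independent), UNCONDITIONAL. -/
theorem pointedRowAt_of_indep_half {p : α} (hp : p ∈ gr M)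
    (h : ∀ X ⊆ gr M, 2 * X.card ≤ (gr M).card → rk M X = X.card) : PointedRowAt M p := by
  intro k hk
  exact pointedRow_level_of_indep_succ hk hp (fun X hX hXc => h X hX (by omega))

/-- The paving theorem again, from the girth regime alone (no condition on the complements). -/
theorem pointedRowAt_of_paving' (hpav : IsPaving M) {p : α} (hp : p ∈ gr M) : PointedRowAt M p := by
  intro k hk
  by_cases hlt : k + rk M (gr M) < (gr M).card
  · rw [biIndepSets_eq_empty_of_lt hlt, card_empty, mul_zero]
    exact Nat.zero_le _
  · have hlt' := not_lt.1 hlt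
    exact pointedRow_level_of_indep_succ hk hp (fun X hX hXc => hpav X hX (by omega))

/-- A failure of (Ĉ) at level `k` needs a DEPENDENT `(k+1)`-subset of `E`. -/
theorem exists_dependent_of_not_pointedRow_level {k : ℕ} (hk : 2 * k + 2 ≤ (gr M).card) {p : α} (hp : p ∈ gr M)
    (hfail : ¬ (((gr M).card - k - 1) * (biIndepSets M k).card ≤
      k * (biIndepSets M (k + 1)).card + ((gr M).card - 2 * k - 1) * extCount M k p)) :
    ∃ X ⊆ gr M, X.card = k + 1 ∧ rk M X < k + 1 := by
  by_contra hcon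
  apply hfail
  apply pointedRow_level_of_indep_succ hk hp
  intro X hX hXc
  apply le_antisymm (by rw [hXc]; exact (rk_le_card X).trans hXc.le)
  exact not_lt.1 (fun hlt => hcon ⟨X, hX, hXc, hXc ▸ hlt⟩)

/-- **A minimal witness fails (Ĉ) at a level `k` with a dependent `(k+1)`-set** (unconditional). -/
theorem MinimalWitness.exists_failing_level {p : α} (h : MinimalWitness M p) :
    ∃ k, 2 * k + 2 ≤ (gr M).card ∧
      ¬ (((gr M).card - k - 1) * (biIndepSets M k).card ≤
        k * (biIndepSets M (k + 1)).card + ((gr M).card - 2 * k - 1) * extCount M k p) ∧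
      ∃ X ⊆ gr M, X.card = k + 1 ∧ rk M X < k + 1 := by
  obtain ⟨hp, hM, -⟩ := h
  obtain ⟨k, hk, hfail⟩ : ∃ k, 2 * k + 2 ≤ (gr M).card ∧
      ¬ (((gr M).card - k - 1) * (biIndepSets M k).card ≤
        k * (biIndepSets M (k + 1)).card + ((gr M).card - 2 * k - 1) * extCount M k p) := by
    by_contra hcon
    exact hM (fun k hk => by_contra (fun hf => hcon ⟨k, hk, hf⟩))
  exact ⟨k, hk, hfail, exists_dependent_of_not_pointedRow_level hk hp hfail⟩

/-- **The failing level of a minimal witness is at least `3`** (mod Theorem A, through gen 24's «every 3-subset of a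
minimal witness is independent»): the dependent `(k+1)`-set has at least `4` elements. -/
theorem MinimalWitness.three_le_failing_level (hfact : BiIndepDensityLogConcave α) {p : α}
    (h : MinimalWitness M p) :
    ∃ k, 3 ≤ k ∧ 2 * k + 2 ≤ (gr M).card ∧
      ¬ (((gr M).card - k - 1) * (biIndepSets M k).card ≤
        k * (biIndepSets M (k + 1)).card + ((gr M).card - 2 * k - 1) * extCount M k p) := by
  obtain ⟨k, hk, hfail, X, hX, hXc, hXr⟩ := h.exists_failing_level
  refine ⟨k, ?_, hk, hfail⟩
  by_contra hlt
  have hind : rk M X = X.card := by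
    rcases (show k = 0 ∨ k = 1 ∨ k = 2 by omega) with rfl | rfl | rfl
    · obtain ⟨x, rfl⟩ := card_eq_one.1 hXc
      rw [card_singleton]
      exact h.loopless (hX (mem_singleton_self x))
    · obtain ⟨x, y, hxy, rfl⟩ := card_eq_two.1 hXc
      rw [hXc]
      exact h.rk_pair hfact (hX (mem_insert_self x {y})) (hX (mem_insert_of_mem (mem_singleton_self y))) hxy
    · rw [hXc]
      exact h.rk_eq_three_of_card_three hfact hX hXc
  omega

/-- **A minimal witness has at least `8` elements** (mod Theorem A): its failing level is `≥ 3` and lies in the window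
`2k + 2 ≤ N`. -/
theorem MinimalWitness.eight_le_card (hfact : BiIndepDensityLogConcave α) {p : α} (h : MinimalWitness M p) :
    8 ≤ (gr M).card := by
  obtain ⟨k, hk3, hk, -⟩ := h.three_le_failing_level hfact
  omega

end PercRepro.Cogirth
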